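import Literature.NumberTheory.Sieve.SmoothLargeValuesNonMajor
import Literature.NumberTheory.Sieve.SmoothLargeValuesMajorEasy
import Literature.NumberTheory.Sieve.SmoothLargeValuesMajorHard
import Literature.NumberTheory.Sieve.MajorArcPairCount
import HarnessLib

/-!
# Large values of exponential sums over smooth numbers, VI: one difference, uniformly

Topic `Literature/NumberTheory/Sieve`; a PROVED file toward
`Literature.NumberTheory.DiophantineGeometry.XYZUpperHalf` ([Harper2016, Cor. 1]). We combine
Propositions 3 and 4 of op. cit. (§4) into one bound, uniform in the difference `t = θ_r − θ_s`:
with `W = x/(yK)`, `𝓜 = prefixSet y W`, `𝓟 = x^α ζ(α,y)/√φ₂(α,y)`, `Q⋆ ≥ 1`,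

`sum_geomBound_prefix_le_weight`:
`∑_{m ∈ 𝓜} min(x/m, 1/(2‖mt‖)) ≤ C · NEG · 𝓟 + x^{19/20} + C ((1 + log y)² (Q⋆yK)^{1−α}) 𝓟 · G_{Q⋆}(t)`,

where `G_Q(t) = majorArcWeight Q x t = ∑_{q ≤ Q} ∑_{a mod q} q⁻¹ (1 + x‖t − a/q‖)⁻¹` is the weight of
Harmonic Analysis Result 2 and
`NEG = (log x)⁴ (yK)^{1−α} y^{(5/2)(1−α)} (K^{1/2−α} + √K Q⋆^{−1/2+(3/2)(1−α)})`
`    + (1+log y)² (1+log Q⋆) Q⋆^{1−α} K^{−α} y^{1−α}`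
`    + log y (1 + log Q⋆ + log K + log(Q⋆²yK²+1)) y^{1−α} (Q⋆²yK²)^{1−α} / K`.
If `t` is not fairly major this is `sum_geomBound_prefix_le_of_not_major`; otherwise
`t = a/q + η₀` with `q ≤ Q⋆`, `(a,q) = 1`, `|η₀| ≤ Q⋆yK/(qx)`, the range `m|η₀|q ≤ 1/2` is
`sum_geomBound_prefix_easy_le`, the range `m|η₀|q > 1/2` is `sum_geomBound_prefix_hard_le`
(after `t ↦ −t` if `η₀ < 0`), and `1/(q(1+|η₀|x)) ≤ G_{Q⋆}(t)`.

## References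

* A. J. Harper, *Minor arcs, mean values, and restriction theory for exponential sums over smooth
  numbers*, Compositio Math. 152 (2016) 1121–1158, §4, Propositions 3–4 [Harper2016].
-/

noncomputable section

open Finset Real
open Literature.NumberTheory.Sieve.Vinogradov
open Literature.NumberTheory.Sieve.BourgainSpacing

namespace Literature.NumberTheory.Sieve

/-- One term of `G_Q(t)`: if `1 ≤ q ≤ Q` and `t = a/q + η₀` (`a ∈ ℤ`) then
`1/(q(1 + |η₀| x)) ≤ majorArcWeight Q x t`. [cite: Harper2016, §4, p. 18 (last display)] -/
theorem inv_le_majorArcWeight {x t η₀ : ℝ} {q Q : ℕ} {a : ℤ} (hx : 0 ≤ x) (hq : 1 ≤ q)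
    (hqQ : q ≤ Q) (ht : t = (a : ℝ) / q + η₀) :
    1 / ((q : ℝ) * (1 + |η₀| * x)) ≤ majorArcWeight Q x t := by
  classical
  have hq0 : (0 : ℝ) < q := by exact_mod_cast hq
  have hqz : (0 : ℤ) < q := by exact_mod_cast hq
  unfold majorArcWeight
  -- the term `q`, `a mod q`
  set b : ℕ := (a % q).toNat with hb
  have hbval : (b : ℤ) = a % q := Int.toNat_of_nonneg (Int.emod_nonneg _ hqz.ne')
  have hbq : b < q := by
    have : (b : ℤ) < q := by rw [hbval]; exact Int.emod_lt_of_pos _ hqz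
    exact_mod_cast this
  have hterm : 1 / ((q : ℝ) * (1 + |η₀| * x)) ≤ (1 / (q : ℝ)) * arcWeight x (t - b / q) := by
    unfold arcWeight
    rw [one_div_mul_one_div]
    have hd0 : 0 ≤ distInt (t - b / q) := distInt_nonneg _
    apply one_div_le_one_div_of_le (by positivity)
    apply mul_le_mul_of_nonneg_left _ hq0.le
    -- `‖t - b/q‖ = ‖η₀ + (a - b)/q‖ = ‖η₀‖ ≤ |η₀|`
    have hk : ∃ k : ℤ, (a : ℝ) - b = q * k := by
      refine ⟨a / q, ?_⟩
      have := Int.emod_add_ediv_mul a q  -- a % q + a / q * q = a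
      have h1 : ((b : ℤ) : ℝ) = ((a % q : ℤ) : ℝ) := by exact_mod_cast hbval
      have h2 : (a : ℝ) = ((a % q : ℤ) : ℝ) + ((a / q : ℤ) : ℝ) * (q : ℝ) := by
        exact_mod_cast this.symm
      push_cast at h1
      rw [h2, ← h1]; ring
    obtain ⟨k, hk⟩ := hk
    have hdist : distInt (t - b / q) = distInt η₀ := by
      have : t - b / q = η₀ + (k : ℝ) := by
        rw [ht]; field_simp; linarith [hk]
      rw [this, distInt_add_int]
    rw [hdist]
    have : distInt η₀ ≤ |η₀| := by
      have := distInt_le_abs_sub_int η₀ 0; simpa using this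
    nlinarith [distInt_nonneg η₀]
  refine hterm.trans ?_
  -- single term ≤ the double sum
  have hqmem : q ∈ Finset.Icc 1 Q := Finset.mem_Icc.mpr ⟨hq, hqQ⟩
  have hbmem : b ∈ Finset.range q := Finset.mem_range.mpr hbq
  have hnonneg : ∀ q' ∈ Finset.Icc 1 Q, ∀ a' ∈ Finset.range q',
      0 ≤ (1 / (q' : ℝ)) * arcWeight x (t - a' / q') := by
    intro q' _ a' _
    unfold arcWeight
    have : 0 ≤ distInt (t - a' / q') := distInt_nonneg _
    positivity
  calc (1 / (q : ℝ)) * arcWeight x (t - b / q)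
      ≤ ∑ a' ∈ Finset.range q, (1 / (q : ℝ)) * arcWeight x (t - a' / q) :=
        Finset.single_le_sum (fun a' ha' => hnonneg q hqmem a' ha') hbmem
    _ ≤ ∑ q' ∈ Finset.Icc 1 Q, ∑ a' ∈ Finset.range q', (1 / (q' : ℝ)) * arcWeight x (t - a' / q') :=
        Finset.single_le_sum (f := fun q' => ∑ a' ∈ Finset.range q', (1 / (q' : ℝ)) * arcWeight x (t - a' / q'))
          (fun q' hq' => Finset.sum_nonneg (hnonneg q' hq')) hqmem

/-- `G_Q(t) ≥ 0`. [folklore] -/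
theorem majorArcWeight_nonneg (Q : ℕ) (x t : ℝ) (hx : 0 ≤ x) : 0 ≤ majorArcWeight Q x t := by
  unfold majorArcWeight arcWeight
  refine Finset.sum_nonneg fun q _ => Finset.sum_nonneg fun a _ => ?_
  have : 0 ≤ distInt (t - a / q) := distInt_nonneg _
  positivity

/-- Lowest terms: for `q ≥ 1` and `a ∈ ℤ` there are `q' ∣ q`… precisely `1 ≤ q' ≤ q` and `a'` coprime
to `q'` with `a/q = a'/q'`. [folklore] -/
theorem exists_coprime_num_den {q : ℕ} (hq : 1 ≤ q) (a : ℤ) :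
    ∃ (q' : ℕ) (a' : ℤ), 1 ≤ q' ∧ q' ≤ q ∧ IsCoprime a' (q' : ℤ) ∧ (a : ℝ) / q = (a' : ℝ) / q' := by
  set ρ : ℚ := (a : ℚ) / (q : ℚ) with hρ
  refine ⟨ρ.den, ρ.num, ρ.den_pos, ?_, Rat.isCoprime_num_den ρ, ?_⟩
  · have h1 : ((ρ.den : ℤ)) ∣ (q : ℤ) := by
      have := Rat.den_dvd a (q : ℤ)
      rwa [Rat.divInt_eq_div, Int.cast_natCast, ← hρ] at this
    have h2 : ρ.den ∣ q := by exact_mod_cast h1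
    exact Nat.le_of_dvd hq h2
  · have h1 : ((ρ : ℚ) : ℝ) = (ρ.num : ℝ) / ρ.den := by exact_mod_cast (Rat.num_div_den ρ).symm
    rw [← h1, hρ]; push_cast; ring

set_option maxHeartbeats 6000000 in
-- a long assembly
/-- **One difference, uniformly** (Harper, Propositions 3 and 4 combined). See the module
docstring. [cite: Harper2016, §4, Propositions 3–4] -/
theorem sum_geomBound_prefix_le_weight :
    ∃ C x₀ : ℝ, 0 < C ∧ ∀ (x : ℝ) (y : ℕ), x₀ ≤ x → Real.log x ^ 8 ≤ y →
      Real.log y ≤ 1 / 2 * Real.log x ^ (1 / 6 : ℝ) → (y : ℝ) ^ 200 ≤ x →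
      ∀ (K : ℕ), 16 ≤ K → (K : ℝ) ^ 1000 ≤ x → ∀ (Qs : ℝ), 1 ≤ Qs → 2 * Qs ≤ x / (y * K) →
      Qs ^ 2 * (K : ℝ) ^ 2 * (y : ℝ) ^ 2 ≤ x → ∀ t : ℝ,
        ∑ m ∈ prefixSet y (x / (y * K)), geomBound (x / m) ((m : ℝ) * t) ≤
          C * (Real.log x ^ 4 * ((y : ℝ) * K) ^ (1 - saddlePoint x y) *
                  (y : ℝ) ^ (5 / 2 * (1 - saddlePoint x y)) *
                  ((K : ℝ) ^ (1 / 2 - saddlePoint x y) +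
                    Real.sqrt K * Qs ^ (-(1 / 2 : ℝ) + 3 / 2 * (1 - saddlePoint x y))) +
                (1 + Real.log y) ^ 2 * (1 + Real.log Qs) * Qs ^ (1 - saddlePoint x y) *
                  (K : ℝ) ^ (-saddlePoint x y) * (y : ℝ) ^ (1 - saddlePoint x y) +
                Real.log y * (1 + Real.log Qs + Real.log K + Real.log (Qs ^ 2 * y * (K : ℝ) ^ 2 + 1)) *
                  (y : ℝ) ^ (1 - saddlePoint x y) * (Qs ^ 2 * y * (K : ℝ) ^ 2) ^ (1 - saddlePoint x y) / K) *
              (x ^ saddlePoint x y *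
                (smoothZeta (saddlePoint x y) y / Real.sqrt (saddlePhi₂ (saddlePoint x y) y))) +
            x ^ (19 / 20 : ℝ) +
            C * ((1 + Real.log y) ^ 2 * (Qs * y * K) ^ (1 - saddlePoint x y)) *
              (x ^ saddlePoint x y *
                (smoothZeta (saddlePoint x y) y / Real.sqrt (saddlePhi₂ (saddlePoint x y) y))) *
              majorArcWeight ⌊Qs⌋₊ x t := by
  classical
  obtain ⟨C_N, x₀N, hC_N, hN⟩ := sum_geomBound_prefix_le_of_not_major
  obtain ⟨C_E, x₀E, hC_E, hE⟩ := sum_geomBound_prefix_easy_le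
  obtain ⟨C_H, x₀H, hC_H, hH⟩ := sum_geomBound_prefix_hard_le
  obtain ⟨x₀1, hlt1⟩ := saddlePoint_lt_one
  refine ⟨C_N + C_E + C_H, max (max (max x₀N x₀E) (max x₀H x₀1)) (Real.exp 4), by positivity,
    fun x y hx hy8 hy6 hy200 K hK16 hK1000 Qs hQs hQsW hQsx t => ?_⟩
  have hx₀N : x₀N ≤ x := le_trans (((le_max_left _ _).trans (le_max_left _ _)).trans (le_max_left _ _)) hx
  have hx₀E : x₀E ≤ x := le_trans (((le_max_right _ _).trans (le_max_left _ _)).trans (le_max_left _ _)) hx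
  have hx₀H : x₀H ≤ x := le_trans (((le_max_left _ _).trans (le_max_right _ _)).trans (le_max_left _ _)) hx
  have hx₀1 : x₀1 ≤ x := le_trans (((le_max_right _ _).trans (le_max_right _ _)).trans (le_max_left _ _)) hx
  have hxe : Real.exp 4 ≤ x := le_trans (le_max_right _ _) hx
  ------------------------------------------------------------------
  -- ### the range
  set Lx := Real.log x with hLx
  have hLx4 : 4 ≤ Lx := by
    have := Real.log_le_log (Real.exp_pos _) hxe; rwa [Real.log_exp] at this
  have hx1 : 1 < x := by
    have : (1 : ℝ) < Real.exp 4 := by have := Real.add_one_le_exp (4 : ℝ); linarith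
    exact lt_of_lt_of_le this hxe
  have hx0 : 0 < x := by linarith
  have hLx1 : 1 ≤ Lx := by linarith
  have hy4 : Real.log x ^ 4 ≤ y := le_trans (pow_le_pow_right₀ hLx1 (by norm_num)) hy8
  have hy256 : (256 : ℝ) ≤ y := by
    have : (4 : ℝ) ^ 4 ≤ Lx ^ 4 := pow_le_pow_left₀ (by norm_num) hLx4 4
    norm_num at this; rw [hLx] at this; linarith
  have hy1 : (1 : ℝ) ≤ y := by linarith
  have hy0 : (0 : ℝ) < y := by linarith
  have hy2 : 2 ≤ y := by exact_mod_cast (show (2 : ℝ) ≤ y by linarith)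
  have hlogy0 : 0 ≤ Real.log y := Real.log_nonneg hy1
  have hy6' : Real.log y ≤ Real.log x ^ (1 / 6 : ℝ) := by
    refine hy6.trans ?_
    have : 0 ≤ Real.log x ^ (1 / 6 : ℝ) := by positivity
    linarith
  have hlogy : Real.log y ≤ Lx := by
    refine hy6'.trans ?_
    calc Real.log x ^ (1 / 6 : ℝ) ≤ Real.log x ^ (1 : ℝ) := Real.rpow_le_rpow_of_exponent_le hLx1 (by norm_num)
      _ = Lx := by rw [Real.rpow_one]
  have hyx : (y : ℝ) ≤ x := by
    rw [← Real.exp_log hy0, ← Real.exp_log hx0]; exact Real.exp_le_exp.mpr hlogy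
  have hK16r : (16 : ℝ) ≤ K := by exact_mod_cast hK16
  have hK0 : (0 : ℝ) < K := by linarith
  have hK1 : 1 ≤ K := by omega
  have hQs0 : 0 < Qs := by linarith
  have hlogQs : 0 ≤ Real.log Qs := Real.log_nonneg hQs
  have hlogK : 0 ≤ Real.log K := Real.log_nonneg (by linarith)
  set α := saddlePoint x y with hαdef
  have hα0 : 0 < α := by rw [hαdef]; exact saddlePoint_pos hx1 hy2
  have hα1 : α ≤ 1 := by
    have hy3 : Real.log x ^ 3 ≤ y := by
      calc Real.log x ^ 3 ≤ Real.log x ^ 4 := pow_le_pow_right₀ hLx1 (by norm_num)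
        _ ≤ y := hy4
    exact (hlt1 x y hx₀1 hy3 hyx hy6').le
  have h1α : 0 ≤ 1 - α := by linarith
  set ζt := smoothZeta α y / Real.sqrt (saddlePhi₂ α y) with hζt
  have hζt0 : 0 ≤ ζt := div_nonneg (smoothZeta_pos hα0).le (Real.sqrt_nonneg _)
  set 𝓟 := x ^ α * ζt with h𝓟
  have h𝓟0 : 0 ≤ 𝓟 := by positivity
  set W := x / (y * K) with hW
  have hyK0 : (0 : ℝ) < y * K := by positivity
  have hW0 : 0 < W := by positivity
  -- the three negligible quantities and the major weight
  set N1 : ℝ := Real.log x ^ 4 * ((y : ℝ) * K) ^ (1 - α) * (y : ℝ) ^ (5 / 2 * (1 - α)) *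
    ((K : ℝ) ^ (1 / 2 - α) + Real.sqrt K * Qs ^ (-(1 / 2 : ℝ) + 3 / 2 * (1 - α))) with hN1
  set N2 : ℝ := (1 + Real.log y) ^ 2 * (1 + Real.log Qs) * Qs ^ (1 - α) * (K : ℝ) ^ (-α) *
    (y : ℝ) ^ (1 - α) with hN2
  set B : ℝ := Qs ^ 2 * y * (K : ℝ) ^ 2 with hB
  have hB0 : 0 < B := by positivity
  set N3 : ℝ := Real.log y * (1 + Real.log Qs + Real.log K + Real.log (B + 1)) *
    (y : ℝ) ^ (1 - α) * B ^ (1 - α) / K with hN3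
  set M : ℝ := (1 + Real.log y) ^ 2 * (Qs * y * K) ^ (1 - α) with hM
  have hLx0 : 0 ≤ Real.log x := by rw [← hLx]; linarith
  have hN1_0 : 0 ≤ N1 := by positivity
  have hN2_0 : 0 ≤ N2 := by positivity
  have hlogB : 0 ≤ Real.log (B + 1) := Real.log_nonneg (by linarith)
  have hN3_0 : 0 ≤ N3 := by positivity
  have hM0 : 0 ≤ M := by positivity
  have hG0 : 0 ≤ majorArcWeight ⌊Qs⌋₊ x t := majorArcWeight_nonneg _ _ _ hx0.le
  set C : ℝ := C_N + C_E + C_H with hC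
  have hCN : C_N ≤ C := by rw [hC]; linarith
  have hCE : C_E ≤ C := by rw [hC]; linarith
  have hCH : C_H ≤ C := by rw [hC]; linarith
  have hC0 : 0 ≤ C := by rw [hC]; positivity
  show ∑ m ∈ prefixSet y W, geomBound (x / m) ((m : ℝ) * t) ≤
    C * (N1 + N2 + N3) * 𝓟 + x ^ (19 / 20 : ℝ) + C * M * 𝓟 * majorArcWeight ⌊Qs⌋₊ x t
  have hx1920 : 0 ≤ x ^ (19 / 20 : ℝ) := by positivity
  ------------------------------------------------------------------
  by_cases hmaj : ∃ q : ℕ, 1 ≤ q ∧ (q : ℝ) ≤ Qs ∧ ∃ a : ℤ, |t - a / q| ≤ Qs * y * K / (q * x)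
  swap
  · ----------------------------------------------------------------
    -- ### not fairly major: Proposition 3
    have hnm : ∀ q : ℕ, 1 ≤ q → (q : ℝ) ≤ Qs → ∀ a : ℤ, Qs * y * K / (q * x) < |t - a / q| := by
      intro q hq hqQ a
      by_contra h
      exact hmaj ⟨q, hq, hqQ, a, not_lt.mp h⟩
    have key₀ := hN x y hx₀N hy8 hy6 hy200 K hK16 hK1000 Qs hQs t hnm
    rw [← hαdef, ← hW] at key₀
    have key : ∑ m ∈ prefixSet y W, geomBound (x / m) ((m : ℝ) * t) ≤ C_N * N1 * 𝓟 + x ^ (19 / 20 : ℝ) := by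
      refine key₀.trans (le_of_eq ?_)
      rw [hN1, h𝓟, hζt]; ring
    have h1 : C_N * N1 * 𝓟 ≤ C * (N1 + N2 + N3) * 𝓟 := by
      apply mul_le_mul_of_nonneg_right _ h𝓟0
      calc C_N * N1 ≤ C * N1 := mul_le_mul_of_nonneg_right hCN hN1_0
        _ ≤ C * (N1 + N2 + N3) := by apply mul_le_mul_of_nonneg_left _ hC0; linarith
    have h2 : 0 ≤ C * M * 𝓟 * majorArcWeight ⌊Qs⌋₊ x t := by positivity
    linarith
  ------------------------------------------------------------------
  -- ### fairly major: Proposition 4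
  obtain ⟨q, hq1, hqQs, a, hta⟩ := hmaj
  obtain ⟨q', a', hq'1, hq'q, hcop, haq⟩ := exists_coprime_num_den hq1 a
  have hq0 : (0 : ℝ) < q := by exact_mod_cast hq1
  have hq'0 : (0 : ℝ) < q' := by exact_mod_cast hq'1
  have hq'r : (q' : ℝ) ≤ q := by exact_mod_cast hq'q
  have hq'Qs : (q' : ℝ) ≤ Qs := hq'r.trans hqQs
  have hq'1r : (1 : ℝ) ≤ q' := by exact_mod_cast hq'1
  set η₀ : ℝ := t - (a' : ℝ) / q' with hη₀
  have ht : t = (a' : ℝ) / q' + η₀ := by rw [hη₀]; ring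
  have hη₀b : |η₀| ≤ Qs * y * K / (q' * x) := by
    have h1 : |η₀| = |t - a / q| := by rw [hη₀, haq]
    rw [h1]
    refine hta.trans ?_
    apply div_le_div_of_nonneg_left (by positivity) (by positivity)
    exact mul_le_mul_of_nonneg_right hq'r hx0.le
  have hη₀W : |η₀| * (q' * x) ≤ Qs * y * K := by
    rwa [le_div_iff₀ (by positivity)] at hη₀b
  -- hypotheses of the two halves
  have h2q' : 2 * (q' : ℝ) ≤ x / (y * K) := by linarith
  have hηK : |η₀| * (q' : ℝ) ^ 2 * K * y ≤ 1 := by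
    -- `|η₀| q'² K y ≤ (Qs yK/(q'x)) q'² K y = Qs q' K² y²/x ≤ Qs² K² y²/x ≤ 1`
    have h1 : |η₀| * (q' : ℝ) ^ 2 * K * y * x = (|η₀| * (q' * x)) * (q' * K * y) := by ring
    have h2 : |η₀| * (q' : ℝ) ^ 2 * K * y * x ≤ Qs ^ 2 * (K : ℝ) ^ 2 * (y : ℝ) ^ 2 := by
      rw [h1]
      calc (|η₀| * (q' * x)) * (q' * K * y) ≤ (Qs * y * K) * (Qs * K * y) := by
            apply mul_le_mul hη₀W _ (by positivity) (by positivity)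
            gcongr
        _ = Qs ^ 2 * (K : ℝ) ^ 2 * (y : ℝ) ^ 2 := by ring
    have h3 : |η₀| * (q' : ℝ) ^ 2 * K * y * x ≤ x := h2.trans hQsx
    have h4 : 0 ≤ |η₀| * (q' : ℝ) ^ 2 * K * y := by positivity
    nlinarith
  ------------------------------------------------------------------
  -- ### split into the easy and hard ranges
  set P : ℕ → Prop := fun m => (m : ℝ) * |η₀| * q' ≤ 1 / 2 with hP
  rw [← Finset.sum_filter_add_sum_filter_not (prefixSet y W) P]
  have hphase : ∀ m : ℕ, (m : ℝ) * t = (m : ℝ) * ((a' : ℝ) / q' + η₀) := fun m => by rw [ht]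
  simp_rw [hphase]
  -- the easy range
  have heasy : ∑ m ∈ (prefixSet y W).filter P, geomBound (x / m) ((m : ℝ) * ((a' : ℝ) / q' + η₀)) ≤
      C_E * (1 + Real.log y) ^ 2 *
        ((1 + Real.log q') * (q' : ℝ) ^ (1 - α) * (K : ℝ) ^ (-α) * (y : ℝ) ^ (1 - α) +
          ((q' : ℝ) * y * K) ^ (1 - α) / ((q' : ℝ) * (1 + |η₀| * x))) * 𝓟 := by
    have key := hE x y hx₀E hy4 hy6' K hK1 q' hq'1 (by rw [← hW]; exact h2q') a' hcop η₀
    rw [← hαdef, ← hW] at key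
    exact key
  -- the hard range
  have hhard : ∑ m ∈ (prefixSet y W).filter (fun m => ¬ P m),
      geomBound (x / m) ((m : ℝ) * ((a' : ℝ) / q' + η₀)) ≤ C_H * N3 * 𝓟 := by
    rcases lt_trichotomy η₀ 0 with hneg | hzero | hpos
    · -- `η₀ < 0`: negate
      have habs : |η₀| = -η₀ := abs_of_neg hneg
      have hfilter : (prefixSet y W).filter (fun m => ¬ P m) =
          (prefixSet y W).filter (fun m : ℕ => 1 / 2 < (m : ℝ) * (-η₀) * q') := by
        apply Finset.filter_congr
        intro m _
        rw [hP]; simp only [habs, not_le]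
      have hterm : ∀ m : ℕ, geomBound (x / m) ((m : ℝ) * ((a' : ℝ) / q' + η₀)) =
          geomBound (x / m) ((m : ℝ) * ((((-a' : ℤ)) : ℝ) / q' + -η₀)) := by
        intro m
        rw [← geomBound_neg (x / m) ((m : ℝ) * ((((-a' : ℤ)) : ℝ) / q' + -η₀))]
        congr 1; push_cast; ring
      rw [hfilter]
      simp_rw [hterm]
      have hcop' : IsCoprime (-a') (q' : ℤ) := hcop.neg_left
      have hηK' : -η₀ * (q' : ℝ) ^ 2 * K * y ≤ 1 := by rwa [habs] at hηK
      have key := hH x y hx₀H hy4 hy6' K hK16 q' hq'1 (-a') hcop' (-η₀) (by linarith) hηK'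
      rw [← hαdef, ← hW] at key
      refine key.trans ?_
      -- monotonicity in `q' ≤ Qs`, `P₀ ≤ B`
      have hnη : 0 < -η₀ := by linarith
      set P₀ : ℝ := (q' : ℝ) ^ 2 * K * (-η₀) * x with hP₀
      have hP₀0 : 0 < P₀ := by positivity
      have hP₀B : P₀ ≤ B := by
        rw [hP₀, hB]
        have h1 : (q' : ℝ) ^ 2 * K * (-η₀) * x = (|η₀| * (q' * x)) * (q' * K) := by rw [habs]; ring
        rw [h1]
        calc (|η₀| * (q' * x)) * (q' * K) ≤ (Qs * y * K) * (Qs * K) := by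
              apply mul_le_mul hη₀W _ (by positivity) (by positivity); gcongr
          _ = Qs ^ 2 * y * (K : ℝ) ^ 2 := by ring
      have hlogq' : Real.log q' ≤ Real.log Qs := Real.log_le_log hq'0 hq'Qs
      have hlogP₀ : Real.log (P₀ + 1) ≤ Real.log (B + 1) := Real.log_le_log (by linarith) (by linarith)
      have hpowP₀ : P₀ ^ (1 - α) ≤ B ^ (1 - α) := Real.rpow_le_rpow hP₀0.le hP₀B h1α
      have hlogP₀0 : 0 ≤ Real.log (P₀ + 1) := Real.log_nonneg (by linarith)
      have hlogq'0 : 0 ≤ Real.log q' := Real.log_nonneg hq'1r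
      rw [hN3]
      have : C_H * Real.log y * (1 + Real.log q' + Real.log K + Real.log (P₀ + 1)) * (y : ℝ) ^ (1 - α) *
          P₀ ^ (1 - α) * 𝓟 / K ≤
          C_H * Real.log y * (1 + Real.log Qs + Real.log K + Real.log (B + 1)) * (y : ℝ) ^ (1 - α) *
          B ^ (1 - α) * 𝓟 / K := by
        apply div_le_div_of_nonneg_right _ hK0.le
        apply mul_le_mul_of_nonneg_right _ h𝓟0
        apply mul_le_mul _ hpowP₀ (by positivity) (by positivity)
        apply mul_le_mul_of_nonneg_right _ (by positivity)
        apply mul_le_mul_of_nonneg_left _ (by positivity)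
        linarith
      refine this.trans (le_of_eq ?_)
      ring
    · -- `η₀ = 0`: the hard range is empty
      have hempty : (prefixSet y W).filter (fun m => ¬ P m) = ∅ := by
        apply Finset.filter_false_of_mem
        intro m _
        rw [hP]; simp only [hzero, abs_zero, mul_zero, zero_mul, not_not]; norm_num
      rw [hempty, Finset.sum_empty]
      positivity
    · -- `η₀ > 0`
      have habs : |η₀| = η₀ := abs_of_pos hpos
      have hfilter : (prefixSet y W).filter (fun m => ¬ P m) =
          (prefixSet y W).filter (fun m : ℕ => 1 / 2 < (m : ℝ) * η₀ * q') := by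
        apply Finset.filter_congr
        intro m _
        rw [hP]; simp only [habs, not_le]
      rw [hfilter]
      have hηK' : η₀ * (q' : ℝ) ^ 2 * K * y ≤ 1 := by rwa [habs] at hηK
      have key := hH x y hx₀H hy4 hy6' K hK16 q' hq'1 a' hcop η₀ hpos hηK'
      rw [← hαdef, ← hW] at key
      refine key.trans ?_
      set P₀ : ℝ := (q' : ℝ) ^ 2 * K * η₀ * x with hP₀
      have hP₀0 : 0 < P₀ := by positivity
      have hP₀B : P₀ ≤ B := by
        rw [hP₀, hB]
        have h1 : (q' : ℝ) ^ 2 * K * η₀ * x = (|η₀| * (q' * x)) * (q' * K) := by rw [habs]; ring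
        rw [h1]
        calc (|η₀| * (q' * x)) * (q' * K) ≤ (Qs * y * K) * (Qs * K) := by
              apply mul_le_mul hη₀W _ (by positivity) (by positivity); gcongr
          _ = Qs ^ 2 * y * (K : ℝ) ^ 2 := by ring
      have hlogq' : Real.log q' ≤ Real.log Qs := Real.log_le_log hq'0 hq'Qs
      have hlogP₀ : Real.log (P₀ + 1) ≤ Real.log (B + 1) := Real.log_le_log (by linarith) (by linarith)
      have hpowP₀ : P₀ ^ (1 - α) ≤ B ^ (1 - α) := Real.rpow_le_rpow hP₀0.le hP₀B h1α
      have hlogP₀0 : 0 ≤ Real.log (P₀ + 1) := Real.log_nonneg (by linarith)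
      have hlogq'0 : 0 ≤ Real.log q' := Real.log_nonneg hq'1r
      rw [hN3]
      have : C_H * Real.log y * (1 + Real.log q' + Real.log K + Real.log (P₀ + 1)) * (y : ℝ) ^ (1 - α) *
          P₀ ^ (1 - α) * 𝓟 / K ≤
          C_H * Real.log y * (1 + Real.log Qs + Real.log K + Real.log (B + 1)) * (y : ℝ) ^ (1 - α) *
          B ^ (1 - α) * 𝓟 / K := by
        apply div_le_div_of_nonneg_right _ hK0.le
        apply mul_le_mul_of_nonneg_right _ h𝓟0
        apply mul_le_mul _ hpowP₀ (by positivity) (by positivity)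
        apply mul_le_mul_of_nonneg_right _ (by positivity)
        apply mul_le_mul_of_nonneg_left _ (by positivity)
        linarith
      refine this.trans (le_of_eq ?_)
      ring
  ------------------------------------------------------------------
  -- ### the easy range: negligible part and the arc weight
  have hwt : 1 / ((q' : ℝ) * (1 + |η₀| * x)) ≤ majorArcWeight ⌊Qs⌋₊ x t :=
    inv_le_majorArcWeight hx0.le hq'1 (Nat.le_floor hq'Qs) ht
  have heasy2 : C_E * (1 + Real.log y) ^ 2 *
      ((1 + Real.log q') * (q' : ℝ) ^ (1 - α) * (K : ℝ) ^ (-α) * (y : ℝ) ^ (1 - α) +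
        ((q' : ℝ) * y * K) ^ (1 - α) / ((q' : ℝ) * (1 + |η₀| * x))) * 𝓟 ≤
      C_E * N2 * 𝓟 + C_E * M * 𝓟 * majorArcWeight ⌊Qs⌋₊ x t := by
    have hlogq' : Real.log q' ≤ Real.log Qs := Real.log_le_log hq'0 hq'Qs
    have hlogq'0 : 0 ≤ Real.log q' := Real.log_nonneg hq'1r
    have hq'pow : (q' : ℝ) ^ (1 - α) ≤ Qs ^ (1 - α) := Real.rpow_le_rpow hq'0.le hq'Qs h1α
    have hq'yK : ((q' : ℝ) * y * K) ^ (1 - α) ≤ (Qs * y * K) ^ (1 - α) :=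
      Real.rpow_le_rpow (by positivity) (by gcongr) h1α
    have h1 : (1 + Real.log q') * (q' : ℝ) ^ (1 - α) * (K : ℝ) ^ (-α) * (y : ℝ) ^ (1 - α) ≤
        (1 + Real.log Qs) * Qs ^ (1 - α) * (K : ℝ) ^ (-α) * (y : ℝ) ^ (1 - α) := by
      apply mul_le_mul_of_nonneg_right _ (by positivity)
      apply mul_le_mul_of_nonneg_right _ (by positivity)
      exact mul_le_mul (by linarith) hq'pow (by positivity) (by linarith)
    have h2 : ((q' : ℝ) * y * K) ^ (1 - α) / ((q' : ℝ) * (1 + |η₀| * x)) ≤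
        (Qs * y * K) ^ (1 - α) * majorArcWeight ⌊Qs⌋₊ x t := by
      rw [div_eq_mul_one_div]
      exact mul_le_mul hq'yK hwt (by positivity) (by positivity)
    have hl2 : 0 ≤ (1 + Real.log y) ^ 2 := by positivity
    calc C_E * (1 + Real.log y) ^ 2 *
          ((1 + Real.log q') * (q' : ℝ) ^ (1 - α) * (K : ℝ) ^ (-α) * (y : ℝ) ^ (1 - α) +
            ((q' : ℝ) * y * K) ^ (1 - α) / ((q' : ℝ) * (1 + |η₀| * x))) * 𝓟
        ≤ C_E * (1 + Real.log y) ^ 2 *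
          ((1 + Real.log Qs) * Qs ^ (1 - α) * (K : ℝ) ^ (-α) * (y : ℝ) ^ (1 - α) +
            (Qs * y * K) ^ (1 - α) * majorArcWeight ⌊Qs⌋₊ x t) * 𝓟 := by
          apply mul_le_mul_of_nonneg_right _ h𝓟0
          apply mul_le_mul_of_nonneg_left (add_le_add h1 h2) (by positivity)
      _ = C_E * N2 * 𝓟 + C_E * M * 𝓟 * majorArcWeight ⌊Qs⌋₊ x t := by rw [hN2, hM]; ring
  ------------------------------------------------------------------
  -- ### combine
  have hfin1 : C_E * N2 * 𝓟 + C_H * N3 * 𝓟 ≤ C * (N1 + N2 + N3) * 𝓟 := by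
    have h1 : C_E * N2 ≤ C * N2 := mul_le_mul_of_nonneg_right hCE hN2_0
    have h2 : C_H * N3 ≤ C * N3 := mul_le_mul_of_nonneg_right hCH hN3_0
    have h3 : 0 ≤ C * N1 := by positivity
    nlinarith
  have hfin2 : C_E * M * 𝓟 * majorArcWeight ⌊Qs⌋₊ x t ≤ C * M * 𝓟 * majorArcWeight ⌊Qs⌋₊ x t := by
    apply mul_le_mul_of_nonneg_right _ hG0
    apply mul_le_mul_of_nonneg_right _ h𝓟0
    exact mul_le_mul_of_nonneg_right hCE hM0
  linarith [heasy, hhard, heasy2, hfin1, hfin2, hx1920]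

end Literature.NumberTheory.Sieve

end
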